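import Literature.Dynamics.TransferOperators.MayerTransferOperatorBounds
import Mathlib.Analysis.Complex.Liouville
import Mathlib.Topology.ContinuousMap.Bounded.ArzelaAscoli
import Mathlib.Topology.MetricSpace.Equicontinuity
import HarnessLib

/-!
# Mayer's transfer operator — compactness (`MayerTransferCompact_holds`)

Companion file to `Literature/Dynamics/TransferOperators/MayerTransferOperator.lean`; it
discharges the named fact `MayerTransferCompact`: for `0 < Re s`, `s ≠ 1/2`, Mayer's transfer
operator `L_s = mayerTransfer s` of the Gauss map is a compact operator on the Banach space
`B(D) = A_∞(D)`, `D = {|z - 1| < 3/2}` [Mayer1990, Prop. 1 (p. 314) and Thm. 5 (pp. 325–327)].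

## The printed proof and the proof given here

Mayer [Mayer1990, proof of Thm. 5, eqs. (58)–(62)] splits, for every `N`,
`L_s = ∑_{k ≤ N} N_s^{(k)} + L_s ∘ P_N`, where `N_s^{(k)} f = f^{(k)}(0)/k! · ζ(2s + k, z + 1)` has
rank one and `P_N f = f - (Taylor polynomial of order N at 0)`; on the range of `P_N` the series
`∑_{n ≥ 1} (z+n)^{-2s} (P_N f)(1/(z+n))` converges uniformly and absolutely on `D̄` as soon as
`Re s > -N/2`, and the resulting operator is nuclear of order zero by Grothendieck's theory of
composition operators on `A_∞(D)` ([Mayer1990, Prop. 1], citing [Mai] = Mayer 1976), because every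
branch `z ↦ 1/(z+n)` maps `D̄` strictly inside `D`.

We follow exactly this architecture with `N = 0` (the case built into `IsMayerTransferAt`):
`L_s = (f ↦ f(0) · L_s 1) + R_s` with `L_s 1 = ζ(2s, · + 1)` (rank one, hence compact) and
`(R_s f)(z) = ∑_{n ≥ 1} (z+n)^{-2s} (f(1/(z+n)) - f(0))`. Mathlib has no nuclear operators, so for
the remainder we prove the weaker printed consequence — compactness — by the elementary version of
the same mechanism: the branches send `D̄` into the disc `|w - 1| ≤ 1`, which is compactly
contained in `D`; by Cauchy's estimate every `f ∈ B(D)` is `4M`-Lipschitz there when `|f| ≤ M` on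
`|w - 1| ≤ 5/4` (`MayerSpace.norm_sub_le_of_bound`), whence the uniform bound
`‖R_s f‖ ≤ C(s) · sup_{|w-1| ≤ 5/4} |f|` with `C(s) = 4 e^{π |Im s|} ∑ₙ (n + 1/2)^{-(2 Re s + 1)}`
(`norm_tsum_mayerTerm_sub_le`; this is where `Re s > 0` enters, as in [Mayer1990, after (65)]);
and the restrictions to `|w - 1| ≤ 5/4` of the unit ball of `B(D)` form a totally bounded set of
`C({|w - 1| ≤ 5/4})` by Arzelà–Ascoli (`MayerSpace.totallyBounded_restrict_unitBall`, again via the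
Cauchy–Lipschitz estimate). An operator dominated in this way by a totally bounded restriction is
compact (`isCompactOperator_of_totallyBounded_image`).

The hypothesis `s ≠ 1/2` of the fact is not needed (at `s = 1/2` the predicate `IsMayerTransferAt`
describes the finite part of `L_s`, which is compact by the same argument); if no bounded operator
acts by Mayer's formula, `mayerTransfer s = 0` is trivially compact.

## References

* [Mayer1990] D. Mayer, On the thermodynamic formalism for the Gauss map, Comm. Math. Phys. 130
  (1990) 311–333: Prop. 1 (p. 314); Thm. 5 and its proof, eqs. (58)–(62) (pp. 325–327).
-/

noncomputable section

open Complex Metric Set Filter Topology Real BoundedContinuousFunction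

namespace Literature.Dynamics.TransferOperators

/-! ### An abstract compactness criterion -/

/-- **Domination by a totally bounded restriction gives compactness.** Let `T : E →L[ℂ] F` be a
bounded operator into a Banach space and `r : E → ι` any map into a pseudometric space such that
`r` sends the closed unit ball of `E` to a totally bounded set and
`‖T x - T y‖ ≤ C · dist (r x) (r y)` on the unit ball. Then `T` is a compact operator (an `ε`-net of
`r(B₁)` is carried to a `Cε`-net of `T(B₁)`). [folklore] -/
theorem isCompactOperator_of_totallyBounded_image {E F ι : Type*} [NormedAddCommGroup E]
    [NormedSpace ℂ E] [NormedAddCommGroup F] [NormedSpace ℂ F] [CompleteSpace F]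
    [PseudoMetricSpace ι] (T : E →L[ℂ] F) (r : E → ι) {C : ℝ} (hC : 0 ≤ C)
    (hr : TotallyBounded (r '' closedBall (0 : E) 1))
    (hT : ∀ x ∈ closedBall (0 : E) 1, ∀ y ∈ closedBall (0 : E) 1,
      ‖T x - T y‖ ≤ C * dist (r x) (r y)) :
    IsCompactOperator T := by
  have key : TotallyBounded (T '' closedBall (0 : E) 1) := by
    refine Metric.totallyBounded_iff.mpr fun ε hε => ?_
    have hC1 : 0 < C + 1 := by linarith
    have hδ : 0 < ε / (C + 1) := div_pos hε hC1
    obtain ⟨t, hts, htf, hcover⟩ := Metric.finite_approx_of_totallyBounded hr (ε / (C + 1)) hδ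
    have hpre : ∀ y ∈ t, ∃ x ∈ closedBall (0 : E) 1, r x = y := fun y hy => hts hy
    choose! g hg using hpre
    refine ⟨(fun y => T (g y)) '' t, htf.image _, ?_⟩
    rintro _ ⟨x, hx, rfl⟩
    obtain ⟨y, hy, hxy⟩ := mem_iUnion₂.mp (hcover (mem_image_of_mem r hx))
    refine mem_iUnion₂.mpr ⟨T (g y), mem_image_of_mem _ hy, ?_⟩
    rw [mem_ball] at hxy
    rw [mem_ball, dist_eq_norm]
    calc ‖T x - T (g y)‖ ≤ C * dist (r x) (r (g y)) := hT x hx (g y) (hg y hy).1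
      _ = C * dist (r x) y := by rw [(hg y hy).2]
      _ ≤ C * (ε / (C + 1)) := mul_le_mul_of_nonneg_left hxy.le hC
      _ < (C + 1) * (ε / (C + 1)) := mul_lt_mul_of_pos_right (by linarith) hδ
      _ = ε := mul_div_cancel₀ ε hC1.ne'
  have hc : IsCompact (closure (T '' closedBall (0 : E) 1)) :=
    key.closure.isCompact_of_isClosed isClosed_closure
  exact (isCompactOperator_iff_isCompact_closure_image_closedBall (T : E →ₗ[ℂ] F) one_pos).mpr hc

/-! ### Cauchy–Lipschitz estimates in `B(D)` -/

namespace MayerSpace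

/-- `toFun` is compatible with subtraction. [folklore] -/
theorem toFun_sub (f g : MayerSpace) : (f - g).toFun = f.toFun - g.toFun := by
  rw [sub_eq_add_neg, ← neg_one_smul ℂ g, toFun_add, toFun_smul, neg_one_smul, sub_eq_add_neg]

/-- **Cauchy–Lipschitz estimate in `B(D)`.** If `g ∈ B(D)` satisfies `‖g‖ ≤ M` on the disc
`|u - 1| ≤ ρ + r` (`0 < r`, `ρ + r ≤ 3/2`), then `g` is `M/r`-Lipschitz on the disc `|w - 1| ≤ ρ`:
Cauchy's estimate `‖g'(x)‖ ≤ M/r` on circles of radius `r`, then the mean value inequality on the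
convex disc. [folklore] -/
theorem norm_sub_le_of_bound (g : MayerSpace) {ρ r M : ℝ} (hr : 0 < r) (hρ : ρ + r ≤ 3 / 2)
    (hM : ∀ u ∈ closedBall (1 : ℂ) (ρ + r), ‖g.toFun u‖ ≤ M) {w₁ w₂ : ℂ}
    (h₁ : w₁ ∈ closedBall (1 : ℂ) ρ) (h₂ : w₂ ∈ closedBall (1 : ℂ) ρ) :
    ‖g.toFun w₁ - g.toFun w₂‖ ≤ M / r * ‖w₁ - w₂‖ := by
  have hball : ∀ x ∈ closedBall (1 : ℂ) ρ, ball x r ⊆ mayerDisc := fun x hx u hu => by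
    rw [mem_closedBall] at hx
    rw [mem_ball] at hu
    rw [mem_mayerDisc]
    calc dist u 1 ≤ dist u x + dist x 1 := dist_triangle u x 1
      _ < r + ρ := add_lt_add_of_lt_of_le hu hx
      _ ≤ 3 / 2 := by linarith
  have hcball : ∀ x ∈ closedBall (1 : ℂ) ρ, closedBall x r ⊆ closedBall (1 : ℂ) (ρ + r) :=
    fun x hx u hu => by
      rw [mem_closedBall] at hx hu ⊢
      calc dist u 1 ≤ dist u x + dist x 1 := dist_triangle u x 1
        _ ≤ r + ρ := add_le_add hu hx
        _ = ρ + r := add_comm r ρ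
  have hsub : closedBall (1 : ℂ) (ρ + r) ⊆ mayerClosedDisc := closedBall_subset_closedBall hρ
  have hderiv : ∀ x ∈ closedBall (1 : ℂ) ρ, ‖deriv g.toFun x‖ ≤ M / r := fun x hx => by
    refine Complex.norm_deriv_le_of_forall_mem_sphere_norm_le hr ⟨?_, ?_⟩ fun u hu => ?_
    · exact g.differentiableOn_toFun.mono (hball x hx)
    · rw [closure_ball x hr.ne']
      exact g.continuousOn_toFun.mono ((hcball x hx).trans hsub)
    · exact hM u (hcball x hx (sphere_subset_closedBall hu))
  have hdiff : ∀ x ∈ closedBall (1 : ℂ) ρ, DifferentiableAt ℂ g.toFun x := fun x hx =>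
    g.differentiableOn_toFun.differentiableAt
      (isOpen_mayerDisc.mem_nhds (hball x hx (mem_ball_self hr)))
  exact (convex_closedBall (1 : ℂ) ρ).norm_image_sub_le_of_norm_deriv_le hdiff hderiv h₂ h₁

/-- **The unit ball of `B(D)` restricts to a totally bounded family on `|w - 1| ≤ 5/4`**
(Arzelà–Ascoli: the restrictions are bounded by `1` and, by the Cauchy–Lipschitz estimate with
`r = 1/4`, uniformly `4`-Lipschitz). This is the compactness of the restriction map from `B(D)` to
`C({|w - 1| ≤ 5/4})` (Montel). [folklore] -/
theorem totallyBounded_restrict_unitBall :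
    TotallyBounded {F : (closedBall (1 : ℂ) (5 / 4)) →ᵇ ℂ |
      ∃ g : MayerSpace, ‖g‖ ≤ 1 ∧ ∀ u : closedBall (1 : ℂ) (5 / 4), F u = g.toFun u} := by
  have hK : closedBall (1 : ℂ) (5 / 4) ⊆ mayerClosedDisc := closedBall_subset_closedBall (by norm_num)
  have hc : IsCompact (closure {F : (closedBall (1 : ℂ) (5 / 4)) →ᵇ ℂ |
      ∃ g : MayerSpace, ‖g‖ ≤ 1 ∧ ∀ u : closedBall (1 : ℂ) (5 / 4), F u = g.toFun u}) := by
    refine BoundedContinuousFunction.arzela_ascoli (closedBall (0 : ℂ) 1) (isCompact_closedBall 0 1)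
      _ ?_ ?_
    · rintro F u ⟨g, hg, hF⟩
      rw [mem_closedBall_zero_iff, hF u]
      exact (g.norm_toFun_le (hK u.2)).trans hg
    · refine Metric.equicontinuous_of_continuity_modulus (fun t => 4 * t)
        ((continuous_const.mul continuous_id).tendsto' (0 : ℝ) 0 (by simp)) _ ?_
      rintro u v ⟨F, g, hg, hF⟩
      show dist (F u) (F v) ≤ 4 * dist u v
      rw [hF u, hF v, dist_eq_norm, Subtype.dist_eq, dist_eq_norm]
      have hM : ∀ w ∈ closedBall (1 : ℂ) (5 / 4 + 1 / 4), ‖g.toFun w‖ ≤ 1 := fun w hw =>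
        (g.norm_toFun_le (closedBall_subset_closedBall (by norm_num) hw)).trans hg
      have h := g.norm_sub_le_of_bound (ρ := 5 / 4) (r := 1 / 4) (M := 1) (by norm_num)
        (by norm_num) hM u.2 v.2
      refine h.trans (le_of_eq ?_)
      norm_num
  exact hc.totallyBounded.subset subset_closure

end MayerSpace

/-! ### The remainder estimate -/

/-- **Remainder estimate** (the `N = 0` case of the estimate in [Mayer1990, proof of Thm. 5,
after (65)]): for `Re s > 0`, `g ∈ B(D)` with `|g| ≤ M` on `|u - 1| ≤ 5/4`, and `z ∈ D̄`,
`‖∑_{n ≥ 1} (z+n)^{-2s} (g(1/(z+n)) - g(0))‖ ≤ 4 M e^{π |Im s|} ∑_{n ≥ 0} (n + 1/2)^{-(2 Re s + 1)}`: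
the points `1/(z+n)` and `0` lie in `|w - 1| ≤ 1`, where `g` is `4M`-Lipschitz, `|1/(z+n)| ≤
1/Re(z+n)`, `|(z+n)^{-2s}| ≤ Re(z+n)^{-2 Re s} e^{π |Im s|}` and `Re (z + n) ≥ n - 1/2`.
[cite: Mayer1990, proof of Thm. 5, pp. 326–327] -/
theorem norm_tsum_mayerTerm_sub_le {s : ℂ} (hs : 0 < s.re) (g : MayerSpace) {M : ℝ}
    (hM : ∀ u ∈ closedBall (1 : ℂ) (5 / 4), ‖g.toFun u‖ ≤ M) {z : ℂ} (hz : z ∈ mayerClosedDisc) :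
    ‖∑' n : ℕ, mayerTerm s (fun w => g.toFun w - g.toFun 0) n z‖ ≤
      4 * M * Real.exp (π / 2 * |(-(2 * s)).im|) *
        ∑' n : ℕ, ((n : ℝ) + 1 / 2) ^ (-(2 * s.re + 1)) := by
  have hM0 : 0 ≤ M := (norm_nonneg _).trans (hM 1 (mem_closedBall_self (by norm_num)))
  set A : ℝ := Real.exp (π / 2 * |(-(2 * s)).im|) with hA
  have hsum : Summable fun n : ℕ => ((n : ℝ) + 1 / 2) ^ (-(2 * s.re + 1)) :=
    summable_nat_add_rpow_neg (by norm_num) (by linarith)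
  rw [← tsum_mul_left]
  refine tsum_of_norm_bounded (hsum.mul_left _).hasSum fun n => ?_
  have hzre := re_ge_of_mem_mayerClosedDisc hz
  -- the real part `x = Re (z + n + 1) ≥ n + 1/2 > 0`
  have hxn : (n : ℝ) + 1 / 2 ≤ (z + (n + 1)).re := by
    simp only [add_re, natCast_re, one_re]
    linarith
  have hn0 : (0 : ℝ) < (n : ℝ) + 1 / 2 := by positivity
  have hx0 : 0 < (z + (n + 1)).re := hn0.trans_le hxn
  -- the branch point `1/(z+n+1)` and `0` lie in `|w - 1| ≤ 1`
  have hw : (1 : ℂ) / (z + (n + 1)) ∈ closedBall (1 : ℂ) 1 :=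
    one_div_mem_closedBall_one_one (by linarith [(n.cast_nonneg : (0 : ℝ) ≤ n)])
  have h0 : (0 : ℂ) ∈ closedBall (1 : ℂ) 1 := by simp
  have hM' : ∀ u ∈ closedBall (1 : ℂ) (1 + 1 / 4), ‖g.toFun u‖ ≤ M := fun u hu =>
    hM u (closedBall_subset_closedBall (by norm_num) hu)
  have hlip := g.norm_sub_le_of_bound (ρ := 1) (r := 1 / 4) (by norm_num) (by norm_num) hM' hw h0
  -- the power
  have hre : (-(2 * s)).re = -(2 * s.re) := by simp
  have hcpow : ‖(z + (n + 1)) ^ (-(2 * s))‖ ≤ (z + (n + 1)).re ^ (-(2 * s.re)) * A := by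
    have h := norm_cpow_le_re_rpow_of_re_pos hx0 (w := -(2 * s)) (by rw [hre]; linarith)
    rwa [hre] at h
  -- the branch point is small: `|1/(z+n+1)| ≤ 1/Re(z+n+1)`
  have hinv : ‖(1 : ℂ) / (z + (n + 1)) - 0‖ ≤ ((z + (n + 1)).re)⁻¹ := by
    rw [sub_zero, norm_div, norm_one, one_div]
    exact inv_anti₀ hx0 (re_le_norm _)
  calc ‖mayerTerm s (fun w => g.toFun w - g.toFun 0) n z‖
      = ‖(z + (n + 1)) ^ (-(2 * s))‖ * ‖g.toFun (1 / (z + (n + 1))) - g.toFun 0‖ := by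
        rw [mayerTerm, norm_mul]
    _ ≤ ((z + (n + 1)).re ^ (-(2 * s.re)) * A) * (M / (1 / 4) * ((z + (n + 1)).re)⁻¹) := by
        refine mul_le_mul hcpow (hlip.trans ?_) (norm_nonneg _) (by positivity)
        exact mul_le_mul_of_nonneg_left hinv (by positivity)
    _ = 4 * M * A * ((z + (n + 1)).re ^ (-(2 * s.re)) * ((z + (n + 1)).re) ^ (-1 : ℝ)) := by
        rw [Real.rpow_neg_one]; ring
    _ = 4 * M * A * (z + (n + 1)).re ^ (-(2 * s.re + 1)) := by
        rw [← Real.rpow_add hx0]; congr 1; ring_nf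
    _ ≤ 4 * M * A * ((n : ℝ) + 1 / 2) ^ (-(2 * s.re + 1)) := by
        refine mul_le_mul_of_nonneg_left ?_ (by positivity)
        exact Real.rpow_le_rpow_of_nonpos hn0 hxn (by linarith)

/-! ### Compactness -/

/-- **Compactness of Mayer's transfer operator** (discharge of `MayerTransferCompact`): for
`0 < Re s`, `s ≠ 1/2`, `L_s = mayerTransfer s` is a compact operator on `B(D)`. Printed statement:
`L_β : A_∞(D) → A_∞(D)` is nuclear of order zero for `Re β > 1/2` [Mayer1990, Prop. 1], and
`β ↦ L_β` extends meromorphically to `ℂ` with values nuclear operators of order zero, poles only at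
`β = (1 - k)/2` [Mayer1990, Thm. 5]; nuclear operators are compact. Proof here: Mayer's `N = 0`
splitting (62), `L_s f = f(0) ζ(2s, · + 1) + R_s f`, the first part of rank one
(`ζ(2s, · + 1) = L_s 1`), the remainder dominated by the sup of `f` over the disc `|w - 1| ≤ 5/4`
compactly contained in `D` (`norm_tsum_mayerTerm_sub_le`), on which the unit ball of `B(D)`
restricts to a totally bounded family (`MayerSpace.totallyBounded_restrict_unitBall`).
[cite: Mayer1990, Prop. 1 (p. 314) and Thm. 5 (pp. 325–327)] -/
theorem MayerTransferCompact_holds : MayerTransferCompact := by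
  intro s hs _
  by_cases hex : ∃ T, IsMayerTransferAt s T
  swap
  · rw [mayerTransfer_of_not_exists hex]
    exact isCompactOperator_zero
  set T : MayerSpace →L[ℂ] MayerSpace := mayerTransfer s with hTdef
  have hT : IsMayerTransferAt s T := isMayerTransferAt_mayerTransfer hex
  -- the constant function `1 ∈ B(D)` and `L_s 1 = ζ(2s, · + 1)`
  set one : MayerSpace := MayerSpace.mk (fun _ => (1 : ℂ)) continuousOn_const
    (differentiableOn_const 1) with hone
  have hone_apply : ∀ w ∈ mayerClosedDisc, one.toFun w = 1 := fun w hw =>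
    MayerSpace.mk_toFun_apply _ _ _ hw
  have hTone : ∀ z ∈ mayerClosedDisc, (T one).toFun z = hurwitzZetaC (2 * s) (z + 1) := by
    intro z hz
    have hterm : (fun n => mayerTerm s (fun w => one.toFun w - one.toFun 0) n z) = fun _ => 0 := by
      funext n
      simp only [mayerTerm, hone_apply _ (one_div_add_mem_mayerClosedDisc hz n),
        hone_apply _ zero_mem_mayerClosedDisc, sub_self, mul_zero]
    have h' : mayerSum₀ s one.toFun z = hurwitzZetaC (2 * s) (z + 1) := by
      show one.toFun 0 * hurwitzZetaC (2 * s) (z + 1) +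
        ∑' n : ℕ, mayerTerm s (fun w => one.toFun w - one.toFun 0) n z = _
      rw [hterm, tsum_zero, add_zero, hone_apply _ zero_mem_mayerClosedDisc, one_mul]
    exact (hT one ⟨z, hz⟩).trans h'
  -- the rank-one part `P f = f(0) • L_s 1`
  set P : MayerSpace →L[ℂ] MayerSpace :=
    (ContinuousLinearMap.toSpanSingleton ℂ (T one)).comp
      (MayerSpace.evalCLM ⟨0, zero_mem_mayerClosedDisc⟩) with hP
  have hP_apply : ∀ g : MayerSpace, P g = g.toFun 0 • T one := fun g => by
    simp only [hP, ContinuousLinearMap.comp_apply, MayerSpace.evalCLM_apply,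
      ContinuousLinearMap.toSpanSingleton_apply]
  have hPc : IsCompactOperator P := by
    have h := (isCompactOperator_of_locallyCompactSpace_dom
      (MayerSpace.evalCLM ⟨0, zero_mem_mayerClosedDisc⟩)).clm_comp
        (ContinuousLinearMap.toSpanSingleton ℂ (T one))
    rw [hP, ContinuousLinearMap.coe_comp]
    exact h
  -- the remainder `R = L_s - P` acts by `∑ₙ (z+n+1)^{-2s} (g(1/(z+n+1)) - g(0))`
  have hR_apply : ∀ (g : MayerSpace), ∀ z ∈ mayerClosedDisc,
      ((T - P) g).toFun z = ∑' n : ℕ, mayerTerm s (fun w => g.toFun w - g.toFun 0) n z := by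
    intro g z hz
    have h1 : ((T - P) g).toFun z = (T g).toFun z - g.toFun 0 * (T one).toFun z := by
      rw [_root_.sub_apply, hP_apply, MayerSpace.toFun_sub, MayerSpace.toFun_smul]
      simp only [Pi.sub_apply, Pi.smul_apply, smul_eq_mul]
    have h2 := hT g ⟨z, hz⟩
    rw [h1, hTone z hz, h2]
    simp only [mayerSum₀]
    ring
  -- the remainder is dominated by the sup over `|w - 1| ≤ 5/4`
  obtain ⟨C, hC0, hC⟩ : ∃ C : ℝ, 0 ≤ C ∧ ∀ (g : MayerSpace) (M : ℝ),
      (∀ u ∈ closedBall (1 : ℂ) (5 / 4), ‖g.toFun u‖ ≤ M) → ‖(T - P) g‖ ≤ C * M := by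
    have hsum : Summable fun n : ℕ => ((n : ℝ) + 1 / 2) ^ (-(2 * s.re + 1)) :=
      summable_nat_add_rpow_neg (by norm_num) (by linarith)
    have hS0 : 0 ≤ ∑' n : ℕ, ((n : ℝ) + 1 / 2) ^ (-(2 * s.re + 1)) :=
      tsum_nonneg fun n => Real.rpow_nonneg (by positivity) _
    refine ⟨4 * Real.exp (π / 2 * |(-(2 * s)).im|) *
      ∑' n : ℕ, ((n : ℝ) + 1 / 2) ^ (-(2 * s.re + 1)), by positivity, fun g M hM => ?_⟩
    have hM0 : 0 ≤ M := (norm_nonneg _).trans (hM 1 (mem_closedBall_self (by norm_num)))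
    refine MayerSpace.norm_le_of_forall_le _ (by positivity) fun z hz => ?_
    rw [hR_apply g z hz]
    calc _ ≤ 4 * M * Real.exp (π / 2 * |(-(2 * s)).im|) *
          ∑' n : ℕ, ((n : ℝ) + 1 / 2) ^ (-(2 * s.re + 1)) := norm_tsum_mayerTerm_sub_le hs g hM hz
      _ = _ := by ring
  -- restriction to the disc `|w - 1| ≤ 5/4`
  have hK : closedBall (1 : ℂ) (5 / 4) ⊆ mayerClosedDisc := closedBall_subset_closedBall (by norm_num)
  have hcont : ∀ g : MayerSpace, Continuous fun u : closedBall (1 : ℂ) (5 / 4) => g.toFun u :=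
    fun g => (g.continuousOn_toFun.mono hK).comp_continuous continuous_subtype_val fun u => u.2
  set res : MayerSpace → (closedBall (1 : ℂ) (5 / 4) →ᵇ ℂ) := fun g =>
    BoundedContinuousFunction.mkOfCompact ⟨fun u => g.toFun u, hcont g⟩ with hres_def
  have hres : ∀ (g : MayerSpace) (u : ℂ) (hu : u ∈ closedBall (1 : ℂ) (5 / 4)),
      res g ⟨u, hu⟩ = g.toFun u := fun g u hu => rfl
  have htb : TotallyBounded (res '' closedBall (0 : MayerSpace) 1) := by
    refine MayerSpace.totallyBounded_restrict_unitBall.subset ?_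
    rintro _ ⟨g, hg, rfl⟩
    exact ⟨g, mem_closedBall_zero_iff.mp hg, fun u => rfl⟩
  have hRc : IsCompactOperator (T - P) := by
    refine isCompactOperator_of_totallyBounded_image (T - P) res hC0 htb fun x _ y _ => ?_
    rw [← map_sub]
    refine hC (x - y) (dist (res x) (res y)) fun u hu => ?_
    rw [MayerSpace.toFun_sub, Pi.sub_apply, ← dist_eq_norm, ← hres x u hu, ← hres y u hu]
    exact BoundedContinuousFunction.dist_coe_le_dist _
  have hfun : ⇑(T - P) + ⇑P = ⇑T := by
    funext g
    simp only [Pi.add_apply, _root_.sub_apply, sub_add_cancel]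
  have hsum := hRc.add hPc
  rwa [hfun] at hsum

end Literature.Dynamics.TransferOperators
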